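import Literature.IUT.HodgeTheaters.BadLocalFrobenioidDashSigmaLift
import Literature.IUT.HodgeTheaters.Cor53iiiAtGoodPlace
import Literature.IUT.HodgeTheaters.GenuineFKitOfBadLocal
import HarnessLib

/-!
# [IUTchI] Cor 5.3 (iii) — the BAD `⊢`-slot at the GENUINE carrier: EVERY topological automorphism of `G_v̲ = Gal(K̄_v̲/K_v̲)`, indeed EVERY
# self-equivalence of `𝒟⊢_v̲ = ℬ(K_v̲)⁰`, lifts to a `τ(q̲_v̲)`-preserving self-equivalence of `𝒞⊢_v̲` (`Φ_{𝒞⊢_v̲} = ℕ·log_Φ(q̲_v̲)`); and the same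
# AT THE MERGE TERM `D.frobeniusBadAt B I x hx` (abc-iut-L5-t4, row R80 (b-ii) «COR53III-BAD-SLOT»; the bad twin of abc-iut-L5-t16's `Cor53iiiAtGoodPlace`)

S. Mochizuki, *Inter-universal Teichmüller theory I*, kurims manuscript (May 2020), §5 Corollary 5.3 (iii) p. 144 l. 16–19: «For `i = 1, 2`, let
`ⁱ𝔉⊢` be an `ℱ⊢`-prime-strip; `ⁱ𝔇⊢` the `𝒟⊢`-prime-strip associated to `ⁱ𝔉⊢` [cf. Remark 5.2.1, (i)]. Then the natural map
`Isom(¹𝔉⊢, ²𝔉⊢) → Isom(¹𝔇⊢, ²𝔇⊢)` [cf. Remark 5.2.1, (i)] is surjective»; proof p. 144 l. 33–36: «follows immediately from […] [AbsTopIII],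
Proposition 5.8, (ii), (v)»; §3 Example 3.2 (iv) p. 71: «the resulting submonoid `Φ_{𝒞⊢_v} := ℕ·log_Φ(q̲_v)|_{𝒟⊢_v} ⊆ Φ_{𝒞_v}|_{𝒟⊢_v}` determines
a `p_v`-adic Frobenioid with base category given by `𝒟⊢_v` [cf. [FrdII], Example 1.1, (ii)]» ([IUTchI] Cor 5.3 (iii) p.144)
[claim: Mochizuki2012, status: disputed] (D-0012 claim key, series status DISPUTED — PROOF-ONLY over landed files; nothing of the series is
asserted; no side is taken on [IUTchIII] Cor. 3.12).  *The Absolute Anabelian Geometry of Hyperbolic Curves* [AbsAnab], Prop. 1.2.1 (iii),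
(iv), (vi) p. 10 [cite: MochizukiAbsAnab2004, Prop 1.2.1 (vi) p.10].

## What this file proves (cell abc-iut; L5 HUB node `IUTchI:Cor5.3(iii)`, BAD `⊢`-SLOT of the telescope of record (abc-iut-L5-lead RULINGS #145/#147);
## PROOF-ONLY: 0 `def` · 0 `instance` · 0 notation · no `Prop` fact; two `private` [folklore] lemmas)

The carrier is GENUINE (R78 census): racer C's `(D.frobeniusBadAt B I x hx).Cdash → .Ddash` IS abc-iut-L5-t2's `(D.gvdAt x _).Cdash hq → CosetCat G_v̲`
(`= BadLocalKit.Cdash`, abc-iut-L1-t4), with `.tauDash = (D.gvdAt x _).tauDashOf hq q̲_v̲` — all `rfl`, independent of the tempered input `I.m1`.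
* §A `Cor53iii.valuation_sigma_eq_of_coe_eq_algebraMap` — the anabelian `σ_α` (abc-iut-w4-d047 `MLFSigma.sigma`, L4 `unitsTransport_holds`) PRESERVES THE
  VALUATION of every INTEGRAL element of `k` (generalising abc-iut-L5-t16's `valuation_sigma_eq_of_coe_eq_p`, same proof: `a^m = π^n·u`);
* §B **`Cor53iii.exists_badDashLift (p) (k) (hq) (β)`** — for EVERY `β : Gal(k̄/k) ≃ₜ* Gal(k̄/k)`: a self-equivalence `Ψ` of
  `𝒞⊢_v̲ := (GaloisValDatum.ofComplete p k).Cdash hq` LYING UNDER `pullSelfEquiv β β⁻¹` through `CdashBase` AND preserving the characteristic splitting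
  `τ(q̲)` (`(ofComplete p k).tauDashOf hq q̲`, abc-iut-L5-t2's `S3Local.CharSplitting.IsPreservedBy`) — this seat's `BadDashSigmaLift` at
  `σ := MLFSigma.sigma k β⁻¹`, `σ' := MLFSigma.sigma k β`; `liesOverClass_badDashLift` (§0 reading); and IN FULL
  **`exists_badDashLift_of_equivalence (E)`** — EVERY self-equivalence `E` of `𝒟⊢_v̲` lifts (`E ≅ pull φ⁻¹`, abc-iut-w4-d058/abc-iut-L1
  `CosetCat.exists_continuousMulEquiv_nonempty_iso_pull` = [SemiAnbd] Prop 3.2 at the profinite Galois-countable `Gal(k̄/k)`);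
* §C AT THE MERGE TERM: **`Cor53iii.exists_badDashLift_frobeniusBadAt`** / **`…_of_equivalence`** at `D.frobeniusBadAt B I x hx` for every bad index `x`
  and every merge record `I` — kit binders ∪ {`B`, `I`, `x`, `hx`} only: LAW ∅ · FACT ∅ · side ∅ · DATA ∅; anabelian inputs = kernel theorems by import.
Print's (iii) asserts SURJECTIVITY only; no rigidity is claimed.  The other members `τ(ζ·q̲_v̲)` of the `μ_{2l}`-orbit `τ⊢_v̲` are permuted by such lifts
(to `τ(σ(ζ)·q̲_v̲)`) — not typed here.  HONEST FRAMING: typed ≠ inhabited ≠ proved; nothing here asserts abc proved or refuted.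
-/

noncomputable section

namespace Literature.IUT.HodgeTheaters

open CategoryTheory Opposite Literature.AnabelianGeometry.SemiGraphs Literature.AlgebraicGeometry.Frobenioids
open Literature.AlgebraicGeometry.Frobenioids.PadicFrd Literature.AnabelianGeometry.AbsoluteAnabelian
open Literature.NumberTheory.GaloisRepresentations
open scoped ValuativeRel

namespace Cor53iii

universe u

/-! ### §A. The anabelian `σ_α` preserves the valuation of every integral element of `k` (MLF currency) -/

section MLF

variable (p : ℕ) [Fact p.Prime] (k : Type) [NontriviallyNormedField k] [CompleteSpace k] [IsUltrametricDist k]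
  [NormedAlgebra ℚ_[p] k] [FiniteDimensional ℚ_[p] k]

/-- **`σ_α` PRESERVES THE VALUATION OF EVERY INTEGRAL `a ∈ k`**: for `x = a ∈ k̄ˣ` with `v(a) ≤ 1`, `v(σ_α x) = v(a)` — `a^m = π^n · u` with `π` a uniformiser
of `k` and `u` an absolute unit (abc-iut-L6-t13 `isAbsInteger_iff_exists_pow_eq`), so `σ_α(a)^m = π'^n · σ_α(u)` with `π'` again a uniformiser of `k`
(`PreservesUniformizers`) and `σ_α(u)` an absolute unit (`PreservesAbsUnits`); valuations of uniformisers of `k` agree and `m`-th powers are injective in the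
value group (the proof of abc-iut-L5-t16's `valuation_sigma_eq_of_coe_eq_p`, verbatim with `p ↦ a`). [cite: MochizukiAbsAnab2004, Prop 1.2.1 (iv) p.10] -/
theorem valuation_sigma_eq_of_coe_eq_algebraMap (α : Field.absoluteGaloisGroup k ≃ₜ* Field.absoluteGaloisGroup k) (x : (AlgebraicClosure k)ˣ) (a : k)
    (hx : (x : AlgebraicClosure k) = algebraMap k (AlgebraicClosure k) a)
    (ha : @ValuativeRel.valuation k _ (GaloisValDatum.normVal k) a ≤ 1) :
    letI := GaloisValDatum.normVal k
    haveI := GoodPlaceSigma.isNonarchimedeanLocalField p k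
    haveI : CharZero k := GaloisValDatum.charZero p k
    @ValuativeRel.valuation (AlgebraicClosure k) _ (GaloisValDatum.ofComplete p k).valΩ (MLFSigma.sigma k α x : AlgebraicClosure k) =
      @ValuativeRel.valuation (AlgebraicClosure k) _ (GaloisValDatum.ofComplete p k).valΩ (algebraMap k (AlgebraicClosure k) a) := by
  letI := GaloisValDatum.normVal k
  haveI := GoodPlaceSigma.isNonarchimedeanLocalField p k
  haveI : CharZero k := GaloisValDatum.charZero p k
  letI : ValuativeRel (AlgebraicClosure k) := (GaloisValDatum.ofComplete p k).valΩ
  haveI : ValuativeExtension k (AlgebraicClosure k) := (GaloisValDatum.ofComplete p k).valExt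
  obtain ⟨π, hπ⟩ := exists_isUniformizer k
  obtain ⟨π₂, hπ₂, hσπ⟩ := MLFSigma.preservesUniformizers_sigma k α π hπ
  have hU := MLFSigma.preservesAbsUnits_sigma k α
  -- `a` is integral in `k̄`, hence `x^m = π^n · u`
  have ha1 : ValuativeRel.valuation (AlgebraicClosure k) (algebraMap k (AlgebraicClosure k) a) ≤ 1 := by
    rw [← (ValuativeRel.valuation (AlgebraicClosure k)).map_one, ← Valuation.Compatible.vle_iff_le, ← (algebraMap k (AlgebraicClosure k)).map_one,
      ValuativeExtension.vle_iff_vle, Valuation.Compatible.vle_iff_le (v := ValuativeRel.valuation k), (ValuativeRel.valuation k).map_one]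
    exact ha
  have hxint : (x : AlgebraicClosure k) ∈ absIntegers 𝒪[k] k :=
    (valuation_closure_le_one_iff_mem_absIntegers p k (x : AlgebraicClosure k)).mp (by rw [hx]; exact ha1)
  obtain ⟨m, n, hm, u, hu, hxu⟩ := (Prop121vii.isAbsInteger_iff_exists_pow_eq k π hπ x).mp hxint
  have hσxu : MLFSigma.sigma k α x ^ m =
      Units.map (algebraMap k (AlgebraicClosure k) : k →* AlgebraicClosure k) π₂ ^ n * MLFSigma.sigma k α u := by
    rw [← map_pow, hxu, map_mul, map_pow, hσπ]
  -- the valuations of the factors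
  have hvπ : ValuativeRel.valuation (AlgebraicClosure k)
        ((Units.map (algebraMap k (AlgebraicClosure k) : k →* AlgebraicClosure k) π₂ : (AlgebraicClosure k)ˣ) : AlgebraicClosure k) =
      ValuativeRel.valuation (AlgebraicClosure k)
        ((Units.map (algebraMap k (AlgebraicClosure k) : k →* AlgebraicClosure k) π : (AlgebraicClosure k)ˣ) : AlgebraicClosure k) := by
    have e : ValuativeRel.valuation k (π₂ : k) = ValuativeRel.valuation k (π : k) := hπ₂.trans hπ.symm
    rw [Units.coe_map, Units.coe_map, MonoidHom.coe_coe, le_antisymm_iff, ← Valuation.Compatible.vle_iff_le, ← Valuation.Compatible.vle_iff_le,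
      ValuativeExtension.vle_iff_vle, ValuativeExtension.vle_iff_vle, Valuation.Compatible.vle_iff_le (v := ValuativeRel.valuation k),
      Valuation.Compatible.vle_iff_le (v := ValuativeRel.valuation k), ← le_antisymm_iff, e]
  have hvu : ValuativeRel.valuation (AlgebraicClosure k) (u : AlgebraicClosure k) = 1 := valuation_eq_one_of_absUnit p k u hu
  have hvσu : ValuativeRel.valuation (AlgebraicClosure k) (MLFSigma.sigma k α u : AlgebraicClosure k) = 1 :=
    valuation_eq_one_of_absUnit p k _ ((hU u).mp hu)
  -- compare `m`-th powers
  have h1 : ValuativeRel.valuation (AlgebraicClosure k) (MLFSigma.sigma k α x : AlgebraicClosure k) ^ m =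
      ValuativeRel.valuation (AlgebraicClosure k)
        ((Units.map (algebraMap k (AlgebraicClosure k) : k →* AlgebraicClosure k) π : (AlgebraicClosure k)ˣ) : AlgebraicClosure k) ^ n := by
    rw [← map_pow, ← Units.val_pow_eq_pow_val, hσxu, Units.val_mul, Units.val_pow_eq_pow_val, map_mul, map_pow, hvσu, mul_one, hvπ]
  have h2 : ValuativeRel.valuation (AlgebraicClosure k) (x : AlgebraicClosure k) ^ m =
      ValuativeRel.valuation (AlgebraicClosure k)
        ((Units.map (algebraMap k (AlgebraicClosure k) : k →* AlgebraicClosure k) π : (AlgebraicClosure k)ˣ) : AlgebraicClosure k) ^ n := by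
    rw [← map_pow, ← Units.val_pow_eq_pow_val, hxu, Units.val_mul, Units.val_pow_eq_pow_val, map_mul, map_pow, hvu, mul_one]
  rw [← hx]
  exact (pow_left_inj₀ zero_le zero_le hm.ne').mp (h1.trans h2.symm)

end MLF

/-! ### §B. EVERY topological automorphism — indeed every self-equivalence of `𝒟⊢_v̲` — lifts to a `τ(q̲)`-preserving self-equivalence of `𝒞⊢_v̲` -/

section GalAux

variable (k : Type) [Field k] (β : Field.absoluteGaloisGroup k ≃ₜ* Field.absoluteGaloisGroup k)

/-- `β ∘ β⁻¹ = id` on `Gal(k̄/k)`, as monoid homomorphisms. [folklore] -/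
private theorem toMonoidHom_comp_symm :
    ((β : Field.absoluteGaloisGroup k ≃* Field.absoluteGaloisGroup k) : Field.absoluteGaloisGroup k →* Field.absoluteGaloisGroup k).comp
        ((β : Field.absoluteGaloisGroup k ≃* Field.absoluteGaloisGroup k).symm : Field.absoluteGaloisGroup k →* Field.absoluteGaloisGroup k) =
      MonoidHom.id _ :=
  MonoidHom.ext (β : Field.absoluteGaloisGroup k ≃* Field.absoluteGaloisGroup k).apply_symm_apply

/-- `β⁻¹ ∘ β = id` on `Gal(k̄/k)`, as monoid homomorphisms. [folklore] -/
private theorem symm_comp_toMonoidHom :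
    ((β : Field.absoluteGaloisGroup k ≃* Field.absoluteGaloisGroup k).symm : Field.absoluteGaloisGroup k →* Field.absoluteGaloisGroup k).comp
        ((β : Field.absoluteGaloisGroup k ≃* Field.absoluteGaloisGroup k) : Field.absoluteGaloisGroup k →* Field.absoluteGaloisGroup k) =
      MonoidHom.id _ :=
  MonoidHom.ext (β : Field.absoluteGaloisGroup k ≃* Field.absoluteGaloisGroup k).symm_apply_apply

end GalAux

section Lift

variable (p : ℕ) [Fact p.Prime] (k : Type) [NontriviallyNormedField k] [CompleteSpace k] [IsUltrametricDist k]
  [NormedAlgebra ℚ_[p] k] [FiniteDimensional ℚ_[p] k] {q : intNonzero (GaloisValDatum.ofComplete p k).k} (hq : ¬ IsUnit q)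
  (β : Field.absoluteGaloisGroup k ≃ₜ* Field.absoluteGaloisGroup k)

/-- **[IUTchI] Cor 5.3 (iii) AT THE GENUINE BAD `⊢`-CARRIER OF AN MLF — EVERY `β ∈ Aut(G_v̲)` LIFTS.**  For every isomorphism of topological groups
`β : Gal(k̄/k) ⥲ Gal(k̄/k)` and every non-unit `q̲ ∈ 𝒪^⊳_k` there is a self-equivalence `Ψ` of `𝒞⊢_v̲ := (ofComplete p k).Cdash hq` (abc-iut-L5-t2's REAL bad-place
`𝒞⊢_v̲` over `𝒟⊢_v̲ = CosetCat Gal(k̄/k)`, `Φ = ℕ·log_Φ(q̲)`) LYING UNDER the transport `pullSelfEquiv β β⁻¹` of `𝒟⊢_v̲` through `CdashBase`, AND preserving the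
characteristic splitting `τ(q̲)` — an automorphism of the split Frobenioid `(𝒞⊢_v̲, τ(q̲))` over `β`: the printed surjectivity onto the class of `β`
([AbsTopIII] Prop 5.8 (ii) route, via `σ_{β⁻¹}` / `σ_β`; `v(σ q̲) = v(q̲)` by §A). ([IUTchI] Cor 5.3 (iii) p.144) [claim: Mochizuki2012, status: disputed] -/
theorem exists_badDashLift :
    ∃ Ψ : (GaloisValDatum.ofComplete p k).Cdash hq ≌ (GaloisValDatum.ofComplete p k).Cdash hq,
      Nonempty (CatIsomorphism.LiesUnder ((GaloisValDatum.ofComplete p k).CdashBase hq) ((GaloisValDatum.ofComplete p k).CdashBase hq) Ψ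
        (PiTransport.pullSelfEquiv _ _ β.continuous β.symm.continuous (toMonoidHom_comp_symm k β) (symm_comp_toMonoidHom k β))) ∧
      ((GaloisValDatum.ofComplete p k).tauDashOf hq q).IsPreservedBy ((GaloisValDatum.ofComplete p k).tauDashOf hq q) Ψ.functor := by
  letI := GaloisValDatum.normVal k
  haveI := GoodPlaceSigma.isNonarchimedeanLocalField p k
  haveI : CharZero k := GaloisValDatum.charZero p k
  letI : ValuativeRel (AlgebraicClosure k) := (GaloisValDatum.ofComplete p k).valΩ
  -- `β` read on `(ofComplete p k).Gal = Gal(k̄/k)`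
  let βm : (AlgebraicClosure k ≃ₐ[k] AlgebraicClosure k) ≃* (AlgebraicClosure k ≃ₐ[k] AlgebraicClosure k) :=
    (β : Field.absoluteGaloisGroup k ≃* Field.absoluteGaloisGroup k)
  have hβc : Continuous βm := β.continuous
  have hβc' : Continuous βm.symm := β.symm.continuous
  -- the anabelian σ's
  let σ : (AlgebraicClosure k)ˣ →* (AlgebraicClosure k)ˣ := (MLFSigma.sigma k β.symm).toMonoidHom
  let σ' : (AlgebraicClosure k)ˣ →* (AlgebraicClosure k)ˣ := (MLFSigma.sigma k β).toMonoidHom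
  have hσ : ∀ (γ : AlgebraicClosure k ≃ₐ[k] AlgebraicClosure k) (y : (AlgebraicClosure k)ˣ), σ (γ • y) = βm.symm γ • σ y :=
    fun γ y => MLFSigma.sigma_smul k β.symm γ y
  have hσ' : ∀ (γ : AlgebraicClosure k ≃ₐ[k] AlgebraicClosure k) (y : (AlgebraicClosure k)ˣ), σ' (γ • y) = βm γ • σ' y :=
    fun γ y => MLFSigma.sigma_smul k β γ y
  have hinv : ∀ y, σ' (σ y) = y := fun y => by
    change MLFSigma.sigma k β (MLFSigma.sigma k β.symm y) = y
    rw [MLFSigma.sigma_symm, MulEquiv.apply_symm_apply]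
  have hinv' : ∀ y, σ (σ' y) = y := fun y => by
    change MLFSigma.sigma k β.symm (MLFSigma.sigma k β y) = y
    rw [MLFSigma.sigma_symm, MulEquiv.symm_apply_apply]
  have hσq : ∀ y : (AlgebraicClosure k)ˣ, (y : AlgebraicClosure k) = algebraMap k (AlgebraicClosure k) (q.1 : k) →
      ValuativeRel.valuation (AlgebraicClosure k) (σ y : AlgebraicClosure k) =
        ValuativeRel.valuation (AlgebraicClosure k) (algebraMap k (AlgebraicClosure k) (q.1 : k)) :=
    fun y hy => valuation_sigma_eq_of_coe_eq_algebraMap p k β.symm y (q.1 : k) hy q.2.1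
  have hσ'q : ∀ y : (AlgebraicClosure k)ˣ, (y : AlgebraicClosure k) = algebraMap k (AlgebraicClosure k) (q.1 : k) →
      ValuativeRel.valuation (AlgebraicClosure k) (σ' y : AlgebraicClosure k) =
        ValuativeRel.valuation (AlgebraicClosure k) (algebraMap k (AlgebraicClosure k) (q.1 : k)) :=
    fun y hy => valuation_sigma_eq_of_coe_eq_algebraMap p k β y (q.1 : k) hy q.2.1
  obtain ⟨Ψ, hΨ, hlies⟩ := BadDashSigmaLift.exists_selfEquivalence_liesUnder_pullSelfEquiv (GaloisValDatum.ofComplete p k) hq βm hβc σ hσ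
    (fun y hy => valuation_sigma_le_one p k β.symm y hy) hσq hβc' σ' hσ' (fun y hy => valuation_sigma_le_one p k β y hy) hσ'q hinv hinv'
  refine ⟨Ψ, hlies, ?_⟩
  rw [hΨ]
  exact BadDashSigmaLift.isPreservedBy_tauDashOf_self_lift (GaloisValDatum.ofComplete p k) hq βm hβc σ hσ
    (fun y hy => valuation_sigma_le_one p k β.symm y hy) hσq hβc' σ' hσ' (fun y hy => valuation_sigma_le_one p k β y hy) hσ'q hinv hinv'

/-- **The §0 reading**: for every `β` there is a §0-AUTOMORPHISM `c` of `𝒞⊢_v̲` LYING OVER the §0-automorphism `[pull β]` of `𝒟⊢_v̲` (abc-iut-L5-t16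
`CatIsomorphism.LiesOverClass`) — the class of `β` is in the image of `Aut(ℱ⊢_v̲) → Aut(𝒟⊢_v̲)`. ([IUTchI] Cor 5.3 (iii) p.144) [claim: Mochizuki2012, status: disputed] -/
theorem liesOverClass_badDashLift :
    ∃ c : CatAut ((GaloisValDatum.ofComplete p k).Cdash hq),
      CatIsomorphism.LiesOverClass ((GaloisValDatum.ofComplete p k).CdashBase hq) c
        (CatIsomorphism.mk (PiTransport.pullSelfEquiv _ _ β.continuous β.symm.continuous (toMonoidHom_comp_symm k β) (symm_comp_toMonoidHom k β))) := by
  obtain ⟨Ψ, ⟨h⟩, -⟩ := exists_badDashLift p k hq β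
  exact ⟨CatIsomorphism.mk Ψ, Ψ, _, rfl, rfl, ⟨h⟩⟩

/-- **[IUTchI] Cor 5.3 (iii), BAD `⊢`-SLOT, IN FULL: EVERY self-equivalence of `𝒟⊢_v̲` lifts to an automorphism of `(𝒞⊢_v̲, τ(q̲_v̲))`.**  For EVERY equivalence
`E : 𝒟⊢_v̲ ⥲ 𝒟⊢_v̲` of the small coset category of `Gal(k̄/k)` there is a self-equivalence `Ψ` of `𝒞⊢_v̲` LYING UNDER `E` through `𝒞⊢_v̲ → 𝒟⊢_v̲` and preserving
`τ(q̲)` — «the natural map `Isom(¹𝔉⊢, ²𝔉⊢) → Isom(¹𝔇⊢, ²𝔇⊢)` […] is surjective» at `¹𝔉⊢ = ²𝔉⊢ =` the genuine bad nonarchimedean model.  `E ≅ pull φ⁻¹` for a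
topological automorphism `φ` (abc-iut-w4-d058/abc-iut-L1 `CosetCat.exists_continuousMulEquiv_nonempty_iso_pull`, [SemiAnbd] Prop 3.2, at the profinite
Galois-countable `Gal(k̄/k)`), then `exists_badDashLift` and this seat's `LiesUnder.ofIsoLower`. ([IUTchI] Cor 5.3 (iii) p.144) [claim: Mochizuki2012, status: disputed] -/
theorem exists_badDashLift_of_equivalence
    (E : CosetCat (AlgebraicClosure k ≃ₐ[k] AlgebraicClosure k) ≌ CosetCat (AlgebraicClosure k ≃ₐ[k] AlgebraicClosure k)) :
    ∃ Ψ : (GaloisValDatum.ofComplete p k).Cdash hq ≌ (GaloisValDatum.ofComplete p k).Cdash hq,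
      Nonempty (CatIsomorphism.LiesUnder ((GaloisValDatum.ofComplete p k).CdashBase hq) ((GaloisValDatum.ofComplete p k).CdashBase hq) Ψ E) ∧
      ((GaloisValDatum.ofComplete p k).tauDashOf hq q).IsPreservedBy ((GaloisValDatum.ofComplete p k).tauDashOf hq q) Ψ.functor := by
  haveI := compactSpace_gal_algebraicClosure p k
  haveI : SecondCountableTopology (AlgebraicClosure k ≃ₐ[k] AlgebraicClosure k) := GaloisValDatum.secondCountableTopology_gal_ofComplete p k
  have hG : IsTempered (AlgebraicClosure k ≃ₐ[k] AlgebraicClosure k) := IsTempered.of_profinite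
  obtain ⟨φ, hc, hs, ⟨j⟩⟩ := CosetCat.exists_continuousMulEquiv_nonempty_iso_pull hG hG E
  obtain ⟨Ψ, ⟨h⟩, hτ⟩ := exists_badDashLift p k hq φ.symm
  exact ⟨Ψ, ⟨h.ofIsoLower j.symm⟩, hτ⟩

end Lift

/-! ### §C. At the merge term: racer C's `frobeniusBadAt` at every bad index -/

section AtTerm

variable {F K Fbar : Type} [Field F] [NumberField F] [Field K] [NumberField K] [Algebra F K]
  [Field Fbar] [Algebra F Fbar] [Algebra K Fbar]
  {E : WeierstrassCurve F} [E.IsElliptic] {l : ℕ} {Pb : BadPlacePredicates K}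
  (D : InitialThetaData F K Fbar E l Pb)
  (B : ∀ v, v ∈ D.indexCopyBad → D.BadPairAt v) (I : D.MergeInputs B) (x : D.IndexCopy) (hx : x ∈ D.indexCopyBad)
  (β : Field.absoluteGaloisGroup (D.KvAt x (D.not_mem_arc_of_mem_bad hx)) ≃ₜ* Field.absoluteGaloisGroup (D.KvAt x (D.not_mem_arc_of_mem_bad hx)))

/-- **[IUTchI] Cor 5.3 (iii), BAD `⊢`-SLOT AT THE MERGE TERM.**  At every bad index `x` of the genuine `ℱ`-kit of record (`GenuineFKitOfBadLocal`, abc-iut-L5-t2), the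
mono-analytic Frobenioid `(D.frobeniusBadAt B I x hx).Cdash → 𝒟⊢_v̲ = CosetCat Gal(K̄_v̲/K_v̲)` (GENUINE: `(D.gvdAt x _).Cdash _`, rfl — it does not see `I.m1`)
admits, for EVERY isomorphism of topological groups `β : Gal(K̄_v̲/K_v̲) ⥲ Gal(K̄_v̲/K_v̲)`, a self-equivalence lying under `pullSelfEquiv β β⁻¹` and preserving
`τ⊢_v̲`'s member `(…).tauDash = τ(q̲_v̲)` — the printed surjectivity onto the class of every `β`, under the binders {`B`, `I`, `x`, `hx`} only: LAW ∅ · FACT ∅.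
([IUTchI] Cor 5.3 (iii) p.144) [claim: Mochizuki2012, status: disputed] -/
theorem exists_badDashLift_frobeniusBadAt :
    ∃ Ψ : (D.frobeniusBadAt B I x hx).Cdash ≌ (D.frobeniusBadAt B I x hx).Cdash,
      Nonempty (CatIsomorphism.LiesUnder (D.frobeniusBadAt B I x hx).CdashBase (D.frobeniusBadAt B I x hx).CdashBase Ψ
        (PiTransport.pullSelfEquiv _ _ β.continuous β.symm.continuous (toMonoidHom_comp_symm (D.KvAt x (D.not_mem_arc_of_mem_bad hx)) β)
          (symm_comp_toMonoidHom (D.KvAt x (D.not_mem_arc_of_mem_bad hx)) β))) ∧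
      (D.frobeniusBadAt B I x hx).tauDash.IsPreservedBy (D.frobeniusBadAt B I x hx).tauDash Ψ.functor := by
  haveI : Fact (D.primeAt x (D.not_mem_arc_of_mem_bad hx)).Prime := D.fact_primeAt_prime x _
  haveI := GaloisValDatum.finiteDimensional_rescaledCompletion K (D.primeAt x (D.not_mem_arc_of_mem_bad hx))
    (D.specAt x (D.not_mem_arc_of_mem_bad hx)) (D.primeAt_mem x (D.not_mem_arc_of_mem_bad hx))
  exact exists_badDashLift (D.primeAt x (D.not_mem_arc_of_mem_bad hx)) (D.KvAt x (D.not_mem_arc_of_mem_bad hx)) (D.qRootAtIdx_not_isUnit x hx) β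

/-- **[IUTchI] Cor 5.3 (iii), BAD `⊢`-SLOT AT THE MERGE TERM, IN FULL**: at every bad index `x`, EVERY self-equivalence `E` of
`𝒟⊢_v̲ = (D.frobeniusBadAt B I x hx).Ddash` (`= CosetCat Gal(K̄_v̲/K_v̲)`, rfl) lifts to a self-equivalence of `(…).Cdash` lying under `E` through `(…).CdashBase` and
preserving `(…).tauDash` — «`Isom(¹𝔉⊢, ²𝔉⊢) → Isom(¹𝔇⊢, ²𝔇⊢)` […] is surjective» at the genuine bad model, binders {`B`, `I`, `x`, `hx`} only: LAW ∅ · FACT ∅ · side ∅.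
([IUTchI] Cor 5.3 (iii) p.144) [claim: Mochizuki2012, status: disputed] -/
theorem exists_badDashLift_frobeniusBadAt_of_equivalence (E : (D.frobeniusBadAt B I x hx).Ddash ≌ (D.frobeniusBadAt B I x hx).Ddash) :
    ∃ Ψ : (D.frobeniusBadAt B I x hx).Cdash ≌ (D.frobeniusBadAt B I x hx).Cdash,
      Nonempty (CatIsomorphism.LiesUnder (D.frobeniusBadAt B I x hx).CdashBase (D.frobeniusBadAt B I x hx).CdashBase Ψ E) ∧
      (D.frobeniusBadAt B I x hx).tauDash.IsPreservedBy (D.frobeniusBadAt B I x hx).tauDash Ψ.functor := by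
  haveI : Fact (D.primeAt x (D.not_mem_arc_of_mem_bad hx)).Prime := D.fact_primeAt_prime x _
  haveI := GaloisValDatum.finiteDimensional_rescaledCompletion K (D.primeAt x (D.not_mem_arc_of_mem_bad hx))
    (D.specAt x (D.not_mem_arc_of_mem_bad hx)) (D.primeAt_mem x (D.not_mem_arc_of_mem_bad hx))
  exact exists_badDashLift_of_equivalence (D.primeAt x (D.not_mem_arc_of_mem_bad hx)) (D.KvAt x (D.not_mem_arc_of_mem_bad hx))
    (D.qRootAtIdx_not_isUnit x hx) E

end AtTerm

end Cor53iii

end Literature.IUT.HodgeTheaters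

end
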